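import Literature.Geometry.Lorentzian.CorrespondingBoundaryShadow
import Literature.Geometry.Lorentzian.CorrespondingBoundaryTimelike
import HarnessLib

/-!
# Corresponding boundary points are limits of timelike curves (Sbierski 2016, Prop. 13 (ii)),
# pure causal form

J. Sbierski, Ann. Henri Poincaré 17 (2016) 301–329 = arXiv:1309.7591v3, §3.2, Prop. 13:

> *(i)* `p ∈ ∂U`, `p' ∈ ∂ψ(U)` are corresponding boundary points *⇒ (ii)* if
> `γ : (−ε, 0) → U` is a timelike curve with `lim_{s ↗ 0} γ(s) = p`, then
> `lim_{s ↗ 0} (ψ ∘ γ)(s) = p'`.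

`CorrespondingBoundaryLimit.lean` proves this over the tree's common globally hyperbolic
developments (`CommonDevelopment.IsCorrespondingPair.tendsto_glue`), for pairs to the FUTURE of
the data hypersurfaces. Here the same printed proof is carried out in the PURE causal setting of
`CorrespondingBoundaryShadow.lean` — two time-oriented Lorentzian manifolds `M₁ ⊇ U ⊇ S₁`,
`M₂ ⊇ W ⊇ S₂` with `S₁`, `S₂` Cauchy hypersurfaces of `M₁`, `M₂` and of the open sub-spacetimes
`U`, `W`; maps `ψ : M₁ → M₂`, `φ : M₂ → M₁` inverse to each other between `U` and `W = ψ(U)` and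
transporting timelike segments inside `U`, `W` (`hpush`, `hpushφ`); the global-hyperbolicity
consequences displayed (sequential closedness of `≤` in `M₁` and `M₂`, strong causality of `M₂`);
a pair `(p, p')`, `p ∈ ∂U`, `p' ∈ I⁺(S₂)`, satisfying the neighbourhood condition of Def. 11 —
so that the time-dual statement (pairs to the past) is the same theorem for the reversed time
orientations, all hypotheses being self-dual. **Theorem
(`LorentzianMetric.tendsto_of_corresponding_future`)**: for every future timelike curve
`γ : [a, b) → U` of `M₁` with `γ t → p` as `t ↑ b`, `ψ (γ t) → p'`.

Proof as printed (and as in `tendsto_glue`): given `V' ∋ p'`, strong causality provides `W' ∋ p'`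
with `I⁺(q') ∩ I⁻(p') ⊆ V'` for `q' ∈ W'` (`IsStronglyCausal.exists_nhds_chronologicalDiamond_subset`);
a point `q' ∈ W'` with `q' ≪ p'` lies in `W` (no timelike entry into `W` from `J⁺(S₂) ∖ W`,
`IsAchronal.mem_opens_of_mem_closure_of_mem_chronologicalFuture`), and `q := φ q' ≪ p` (first step
of the printed proof for the symmetric pair: `φ q' ≪ φ s' ≤ p` for `q' ≪ s' ≪ p'`,
`glue_mem_chronologicalFuture_of_mem`, `mem_causalFuture_glue_of_corresponding`, push-up); eventually
`q ≪ γ t ≪ p`, whence `q' ≪ ψ(γ t) ≪ p'` (the first step again), i.e. `ψ(γ t) ∈ V'`.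

Everything is proved; no definitions, no named facts (D-0026).

## References

* J. Sbierski, Ann. Henri Poincaré 17 (2016) 301–329 = arXiv:1309.7591v3, §3.2, Def. 11 and
  Prop. 13 with its proof and footnotes (arXiv numbering). [Sbierski2016AHP]
* B. O'Neill, *Semi-Riemannian geometry with applications to relativity*, Academic Press 1983,
  Ch. 14, Lemma 14.3, Cor. 14.1, Lemma 14.22, p. 437 (strong causality). [ONeillSemiRiemannian1983]
-/

noncomputable section

open Set Filter Function TopologicalSpace Topology
open scoped Manifold ContDiff Topology

namespace Literature.Geometry.Lorentzian

namespace LorentzianMetric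

section Core

variable {E₁ : Type*} [NormedAddCommGroup E₁] [NormedSpace ℝ E₁] {H₁ : Type*} [TopologicalSpace H₁]
  {I₁ : ModelWithCorners ℝ E₁ H₁} {n₁ : ℕ∞ω} {M₁ : Type*} [TopologicalSpace M₁] [ChartedSpace H₁ M₁]
  [IsManifold I₁ ∞ M₁] [T2Space M₁] [SecondCountableTopology M₁] [BoundarylessManifold I₁ M₁]
  [FiniteDimensional ℝ E₁] {g₁ : LorentzianMetric I₁ n₁ M₁} {τ₁ : TimeOrientation g₁}
  {E₂ : Type*} [NormedAddCommGroup E₂] [NormedSpace ℝ E₂] {H₂ : Type*} [TopologicalSpace H₂]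
  {I₂ : ModelWithCorners ℝ E₂ H₂} {n₂ : ℕ∞ω} {M₂ : Type*} [TopologicalSpace M₂] [ChartedSpace H₂ M₂]
  [IsManifold I₂ ∞ M₂] [T2Space M₂] [SecondCountableTopology M₂] [BoundarylessManifold I₂ M₂]
  [FiniteDimensional ℝ E₂] {g₂ : LorentzianMetric I₂ n₂ M₂} {τ₂ : TimeOrientation g₂}

/-- **The first step of Prop. 13 for the inverse pair**: if `(p, p')` satisfies the neighbourhood
condition of corresponding boundary points, `φ` inverts `ψ` between `U` and `W`, `q' ∈ W` and
`q' ≪ p'`, then `φ q' ≪ p` — via a point `s' ∈ W` with `q' ≪ s' ≪ p'`: `φ q' ≪ φ s'` (transport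
inside `W`) and `φ s' ≤ p` (`mem_causalFuture_glue_of_corresponding` for the swapped data), then
push-up. Sbierski 2016, §3.2, proof of Prop. 13 ("we know that `q := ψ⁻¹(q') ∈ I⁻(p, M)`").
[cite: Sbierski2016AHP, §3.2, proof of Prop. 13 (arXiv numbering)] -/
theorem mem_chronologicalFuture_inv_of_corresponding (hn₁ : 2 ≤ n₁) (hn₂ : 2 ≤ n₂)
    (hres₂ : PseudoRiemannianMetric.contMDiff_restrict (I := I₂) (n := n₂) (M := M₂))
    (hτ₂ : τ₂.contMDiff_restrict) {U : Opens M₁}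
    {S₂ : Set M₂} (hS₂ : g₂.IsCauchyHypersurface τ₂ S₂) {W : Opens M₂}
    (hW : (g₂.restrict hres₂ W).IsCauchyHypersurface (τ₂.restrict hres₂ hτ₂ W) (Subtype.val ⁻¹' S₂))
    {ψ : M₁ → M₂} {φ : M₂ → M₁} (hψW : MapsTo ψ U W) (hφψ : ∀ y ∈ (U : Set M₁), φ (ψ y) = y)
    (hpushφ : ∀ ⦃γ : ℝ → M₂⦄ ⦃a b : ℝ⦄, a < b → g₂.IsFutureTimelikeCurveOn τ₂ γ (Icc a b) →
      (∀ t ∈ Icc a b, γ t ∈ W) → φ (γ b) ∈ g₁.chronologicalFuture τ₁ {φ (γ a)})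
    (hrel₁ : ∀ {xs ys : ℕ → M₁} {x y : M₁}, Tendsto xs atTop (𝓝 x) → Tendsto ys atTop (𝓝 y) →
      (∀ j, ys j ∈ g₁.causalFuture τ₁ {xs j}) → y ∈ g₁.causalFuture τ₁ {x})
    {p : M₁} {p' : M₂}
    (hcorr : ∀ V ∈ 𝓝 p, ∀ V' ∈ 𝓝 p', ∃ y ∈ (U : Set M₁), y ∈ V ∧ ψ y ∈ V')
    {q' : M₂} (hq'W : q' ∈ W) (hp'q' : p' ∈ g₂.chronologicalFuture τ₂ {q'}) :
    p ∈ g₁.chronologicalFuture τ₁ {φ q'} := by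
  have hn1' : (1 : ℕ∞ω) ≤ n₁ := le_trans one_le_two hn₁
  -- `p' ∈ closure W` and the neighbourhood condition for the swapped pair
  have hp'cl : p' ∈ closure (W : Set M₂) := by
    rw [mem_closure_iff_nhds]
    intro V' hV'
    obtain ⟨y, hyU, -, hyV'⟩ := hcorr univ univ_mem V' hV'
    exact ⟨ψ y, hyV', hψW hyU⟩
  have hcorr' : ∀ V' ∈ 𝓝 p', ∀ V ∈ 𝓝 p, ∃ z ∈ (W : Set M₂), z ∈ V' ∧ φ z ∈ V := by
    intro V' hV' V hV
    obtain ⟨y, hyU, hyV, hyV'⟩ := hcorr V hV V' hV'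
    exact ⟨ψ y, hψW hyU, hyV', by rw [hφψ y hyU]; exact hyV⟩
  -- a point `s'` with `q' ≪ s' ≪ p'`, in `W`
  obtain ⟨s', hq's', hs'p'⟩ : (g₂.chronologicalFuture τ₂ {q'} ∩
      g₂.chronologicalPast τ₂ {p'}).Nonempty :=
    mem_closure_iff_nhds.1
      (subset_closure_chronologicalFuture (g := g₂) (τ := τ₂.reverse) {p'} rfl) _
      ((isOpen_chronologicalFuture_of_boundaryless _ _ _).mem_nhds hp'q')
  have hs'W : s' ∈ W :=
    hS₂.chronologicalFuture_inter_chronologicalPast_subset_opens hn₂ _ _ hW hq'W hp'cl ⟨hq's', hs'p'⟩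
  have hp's' : p' ∈ g₂.chronologicalFuture τ₂ {s'} :=
    mem_chronologicalFuture_of_mem_chronologicalPast hs'p'
  -- `φ q' ≪ φ s' ≤ p`
  have h1 : φ s' ∈ g₁.chronologicalFuture τ₁ {φ q'} :=
    glue_mem_chronologicalFuture_of_mem hn₂ hres₂ hτ₂ hS₂ hW hpushφ hq'W hs'W hq's'
  have h2 : p ∈ g₁.causalFuture τ₁ {φ s'} :=
    mem_causalFuture_glue_of_corresponding hn₂ hres₂ hτ₂ hS₂ hW hpushφ hrel₁ hcorr' hs'W hp's'
  exact mem_chronologicalFuture_of_mem_chronologicalFuture_of_mem_causalFuture hn1' h1 h2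

/-- **Sbierski 2016, Prop. 13, (i) ⇒ (ii), pure causal form** (pairs to the future of the Cauchy
hypersurfaces; see the module docstring for the setting and the proof). For a pair `(p, p')`,
`p ∈ ∂U`, `p' ∈ I⁺(S₂)`, satisfying the neighbourhood condition of corresponding boundary points,
and a future timelike curve `γ : [a, b) → U` of `M₁` with `γ t → p` as `t ↑ b`: `ψ (γ t) → p'`.
[cite: Sbierski2016AHP, §3.2, Prop. 13 (i) ⇒ (ii) (arXiv numbering)] -/
theorem tendsto_of_corresponding_future (hn₁ : 2 ≤ n₁) (hn₂ : 2 ≤ n₂)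
    (hres₁ : PseudoRiemannianMetric.contMDiff_restrict (I := I₁) (n := n₁) (M := M₁))
    (hτ₁ : τ₁.contMDiff_restrict) {S₁ : Set M₁} (hS₁ : g₁.IsCauchyHypersurface τ₁ S₁)
    {U : Opens M₁}
    (hU : (g₁.restrict hres₁ U).IsCauchyHypersurface (τ₁.restrict hres₁ hτ₁ U) (Subtype.val ⁻¹' S₁))
    (hres₂ : PseudoRiemannianMetric.contMDiff_restrict (I := I₂) (n := n₂) (M := M₂))
    (hτ₂ : τ₂.contMDiff_restrict) {S₂ : Set M₂} (hS₂ : g₂.IsCauchyHypersurface τ₂ S₂) {W : Opens M₂}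
    (hW : (g₂.restrict hres₂ W).IsCauchyHypersurface (τ₂.restrict hres₂ hτ₂ W) (Subtype.val ⁻¹' S₂))
    {ψ : M₁ → M₂} {φ : M₂ → M₁} (hψW : MapsTo ψ U W) (hφU : MapsTo φ W U)
    (hφψ : ∀ y ∈ (U : Set M₁), φ (ψ y) = y) (hψφ : ∀ z ∈ (W : Set M₂), ψ (φ z) = z)
    (hpush : ∀ ⦃γ : ℝ → M₁⦄ ⦃a b : ℝ⦄, a < b → g₁.IsFutureTimelikeCurveOn τ₁ γ (Icc a b) →
      (∀ t ∈ Icc a b, γ t ∈ U) → ψ (γ b) ∈ g₂.chronologicalFuture τ₂ {ψ (γ a)})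
    (hpushφ : ∀ ⦃γ : ℝ → M₂⦄ ⦃a b : ℝ⦄, a < b → g₂.IsFutureTimelikeCurveOn τ₂ γ (Icc a b) →
      (∀ t ∈ Icc a b, γ t ∈ W) → φ (γ b) ∈ g₁.chronologicalFuture τ₁ {φ (γ a)})
    (hrel₁ : ∀ {xs ys : ℕ → M₁} {x y : M₁}, Tendsto xs atTop (𝓝 x) → Tendsto ys atTop (𝓝 y) →
      (∀ j, ys j ∈ g₁.causalFuture τ₁ {xs j}) → y ∈ g₁.causalFuture τ₁ {x})
    (hrel₂ : ∀ {xs ys : ℕ → M₂} {x y : M₂}, Tendsto xs atTop (𝓝 x) → Tendsto ys atTop (𝓝 y) →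
      (∀ j, ys j ∈ g₂.causalFuture τ₂ {xs j}) → y ∈ g₂.causalFuture τ₂ {x})
    (hSC₂ : g₂.IsStronglyCausal τ₂)
    {p : M₁} {p' : M₂} (hp'I : p' ∈ g₂.chronologicalFuture τ₂ S₂)
    (hcorr : ∀ V ∈ 𝓝 p, ∀ V' ∈ 𝓝 p', ∃ y ∈ (U : Set M₁), y ∈ V ∧ ψ y ∈ V')
    {γ : ℝ → M₁} {a b : ℝ} (hab : a < b) (hγ : g₁.IsFutureTimelikeCurveOn τ₁ γ (Ico a b))
    (hγU : ∀ t ∈ Ico a b, γ t ∈ U) (hlim : Tendsto γ (𝓝[<] b) (𝓝 p)) :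
    Tendsto (ψ ∘ γ) (𝓝[<] b) (𝓝 p') := by
  haveI : LocallyCompactSpace M₁ := Manifold.locallyCompact_of_finiteDimensional (M := M₁) I₁
  haveI : TopologicalSpace.MetrizableSpace M₁ := Manifold.metrizableSpace I₁ M₁
  letI : MetricSpace M₁ := TopologicalSpace.metrizableSpaceMetric M₁
  have hn1 : (1 : ℕ∞ω) ≤ n₁ := le_trans one_le_two hn₁
  have hn1' : (1 : ℕ∞ω) ≤ n₂ := le_trans one_le_two hn₂
  -- (a) `γ t ≪ p` for every `t`
  have hγp : ∀ t ∈ Ico a b, p ∈ g₁.chronologicalFuture τ₁ {γ t} := by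
    intro t ht
    set t₁ : ℝ := (t + b) / 2 with ht₁
    have htt₁ : t < t₁ := by rw [ht₁]; linarith [ht.2]
    have ht₁b : t₁ < b := by rw [ht₁]; linarith [ht.2]
    have h1 : γ t₁ ∈ g₁.chronologicalFuture τ₁ {γ t} :=
      ⟨γ t, rfl, γ, t, t₁, htt₁, hγ.mono (Icc_subset_Ico_right ht₁b |>.trans
        (Ico_subset_Ico_left ht.1)), rfl, rfl⟩
    have h2 : p ∈ g₁.causalFuture τ₁ {γ t₁} := by
      refine mem_causalFuture_of_mem_closure_chronologicalFuture hrel₁ ?_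
      refine mem_closure_of_tendsto hlim ?_
      filter_upwards [Ioo_mem_nhdsLT ht₁b] with t₂ ht₂
      exact ⟨γ t₁, rfl, γ, t₁, t₂, ht₂.1, hγ.mono ((Icc_subset_Ico_right ht₂.2).trans
        (Ico_subset_Ico_left (ht.1.trans htt₁.le))), rfl, rfl⟩
    exact mem_chronologicalFuture_of_mem_chronologicalFuture_of_mem_causalFuture hn1 h1 h2
  -- `ψ (γ t) ≪ p'` for every `t` (the first step of the printed proof)
  have hψγp' : ∀ t ∈ Ico a b, p' ∈ g₂.chronologicalFuture τ₂ {ψ (γ t)} := by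
    intro t ht
    set t₁ : ℝ := (t + b) / 2 with ht₁
    have htt₁ : t < t₁ := by rw [ht₁]; linarith [ht.2]
    have ht₁b : t₁ < b := by rw [ht₁]; linarith [ht.2]
    have ht₁' : t₁ ∈ Ico a b := ⟨ht.1.trans htt₁.le, ht₁b⟩
    have h1 : γ t₁ ∈ g₁.chronologicalFuture τ₁ {γ t} :=
      ⟨γ t, rfl, γ, t, t₁, htt₁, hγ.mono (Icc_subset_Ico_right ht₁b |>.trans
        (Ico_subset_Ico_left ht.1)), rfl, rfl⟩
    have h2 : ψ (γ t₁) ∈ g₂.chronologicalFuture τ₂ {ψ (γ t)} :=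
      glue_mem_chronologicalFuture_of_mem hn₁ hres₁ hτ₁ hS₁ hU hpush (hγU t ht) (hγU t₁ ht₁') h1
    have h3 : p' ∈ g₂.causalFuture τ₂ {ψ (γ t₁)} :=
      mem_causalFuture_glue_of_corresponding hn₁ hres₁ hτ₁ hS₁ hU hpush hrel₂ hcorr (hγU t₁ ht₁')
        (hγp t₁ ht₁')
    exact mem_chronologicalFuture_of_mem_chronologicalFuture_of_mem_causalFuture hn1' h2 h3
  -- (b) the strong-causality box and a point `q' ≪ p'` of `W` in it
  rw [tendsto_def]
  intro V' hV'
  obtain ⟨W', hW', -, hbox⟩ := hSC₂.exists_nhds_chronologicalDiamond_subset p' hV'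
  have hA₂ : g₂.IsAchronal τ₂ S₂ := IsCauchyHypersurface.isAchronal_holds hn₂ hS₂
  have hp'cl : p' ∈ closure (W : Set M₂) := by
    rw [mem_closure_iff_nhds]
    intro V'' hV''
    obtain ⟨y, hyU, -, hyV''⟩ := hcorr univ univ_mem V'' hV''
    exact ⟨ψ y, hyV'', hψW hyU⟩
  obtain ⟨q', ⟨hq'W', hq'I⟩, hq'p⟩ : ((W' ∩ g₂.chronologicalFuture τ₂ S₂) ∩
      g₂.chronologicalPast τ₂ {p'}).Nonempty := by
    have hnhds : W' ∩ g₂.chronologicalFuture τ₂ S₂ ∈ 𝓝 p' :=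
      inter_mem hW' ((isOpen_chronologicalFuture_of_boundaryless _ _ _).mem_nhds hp'I)
    have hcl : p' ∈ closure (g₂.chronologicalPast τ₂ {p'}) :=
      subset_closure_chronologicalFuture (g := g₂) (τ := τ₂.reverse) {p'} rfl
    exact mem_closure_iff_nhds.1 hcl _ hnhds
  have hp'q' : p' ∈ g₂.chronologicalFuture τ₂ {q'} :=
    mem_chronologicalFuture_of_mem_chronologicalPast hq'p
  have hq'W : q' ∈ W :=
    hA₂.mem_opens_of_mem_closure_of_mem_chronologicalFuture hn₂ _ _ hW
      (chronologicalFuture_subset_causalFuture _ _ _ hq'I) hp'cl hp'q'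
  -- (c) `q := φ q' ≪ p`
  have hqp : p ∈ g₁.chronologicalFuture τ₁ {φ q'} :=
    mem_chronologicalFuture_inv_of_corresponding hn₁ hn₂ hres₂ hτ₂ hS₂ hW hψW hφψ hpushφ hrel₁
      hcorr hq'W hp'q'
  have hqU : φ q' ∈ U := hφU hq'W
  -- (d) eventually `q ≪ γ t`, and then `ψ (γ t) ∈ I⁺(q') ∩ I⁻(p') ⊆ V'`
  have hev : ∀ᶠ t in 𝓝[<] b, γ t ∈ g₁.chronologicalFuture τ₁ {φ q'} :=
    hlim ((isOpen_chronologicalFuture_of_boundaryless _ _ _).mem_nhds hqp)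
  filter_upwards [hev, Ico_mem_nhdsLT hab] with t hqt ht
  have h1 : ψ (γ t) ∈ g₂.chronologicalFuture τ₂ {q'} := by
    have h := glue_mem_chronologicalFuture_of_mem hn₁ hres₁ hτ₁ hS₁ hU hpush hqU (hγU t ht) hqt
    rwa [hψφ q' hq'W] at h
  exact hbox q' hq'W' ⟨h1, mem_chronologicalPast_of_mem_chronologicalFuture (hψγp' t ht)⟩

end Core

end LorentzianMetric

end Literature.Geometry.Lorentzian

end
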